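import Literature.Computability.MetaComplexity.EFScaffold
import Literature.Computability.MetaComplexity.FregeBounded
import HarnessLib

/-!
# From bounded Frege derivations to extended Frege proofs: blocks, modus ponens, packaging

Topic `Literature/Computability/MetaComplexity`. A small kit connecting the bounded
hypothesis-free derivations `TextbookFrege.BD` (`FregeBounded.lean`, tree-like, with size and
depth accounting) to the dag-like blocks `FregeSystem.IsBlock` and relaxed extended Frege
sequences `FregeSystem.IsRelaxedEF` of `EFScaffold.lean`, for the concrete system
`textbookFrege`:

* `TextbookFrege.isBlock_of_isDerivation` / `BD.exists_isBlock` — a `textbookFrege`-derivation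
  from no hypotheses is a block over any available set; a `BD D B ℓ φ` derivation yields a block
  of at most `ℓ` lines of size `≤ B` containing `φ`;
* `TextbookFrege.mpBlock P Q` — **modus ponens as a five-line block**: from available `P` and
  `¬P ∨ Q` the lines `Q ∨ P`, `¬Q ∨ Q`, `P ∨ Q`, `Q ∨ Q`, `Q` (expansion, axiom, two cuts,
  contraction); `mpChain` iterates it along a list of available antecedents, turning an available
  `¬A₁ ∨ (⋯ ∨ (¬A_k ∨ ⋁R))` into `⋁R`;
* `TextbookFrege.removeBotBlock C` — from available `C ∨ ⊥` the line `C` (seven lines);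
* `TextbookFrege.exists_isEFProofOf_of_isBlock` — **packaging**: well-allocated definitions
  `E` (`IsExtList`) above the variables of `φ` followed by a block over the extension axioms
  containing `φ` give an extended Frege proof of `φ` of size `≤ |extAxioms E| + |block|`.

So a polynomial-size EF proof can be assembled from hypothesis-free tautologies (derived with
the sequent toolkit) and modus ponens against the extension axioms and earlier lines, with all
sharing done at the block level.

References: S. A. Cook, R. A. Reckhow, *The relative efficiency of propositional proof
systems*, J. Symbolic Logic 44 (1979), §2 (derivations), §4 (extension axioms); J. R.
Shoenfield, *Mathematical Logic* (1967), §2.6 (the rules; detachment and commutativity as derived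
rules). The bookkeeping is folklore.
-/

namespace Literature.Computability.MetaComplexity

open Complexity Complexity.PropForm FregeSystem

namespace TextbookFrege

/-! ### Derivations are blocks -/

/-- A `textbookFrege`-derivation from no hypotheses is a block over every available set.
[cite: CookReckhow1979, §2 (derivations)] -/
theorem isBlock_of_isDerivation {π : List (PropForm ℕ)} (h : textbookFrege.IsDerivation ∅ π)
    (Γ : Set (PropForm ℕ)) : textbookFrege.IsBlock Γ π := by
  intro k hk
  rcases h k hk with hm | hinf
  · exact absurd hm (Set.notMem_empty _)
  · exact Or.inr (IsInferredFrom.mono (isInferred_iff_isInferredFrom.1 hinf) Set.subset_union_right)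

/-- **A bounded derivation as a block**: at most `ℓ` lines, each of size `≤ B`, containing `φ`,
of total size `≤ ℓ · B`. [folklore] -/
theorem BD.exists_isBlock {D B ℓ : ℕ} {φ : PropForm ℕ} (h : BD D B ℓ φ) (Γ : Set (PropForm ℕ)) :
    ∃ π : List (PropForm ℕ), textbookFrege.IsBlock Γ π ∧ φ ∈ π ∧ proofSize π ≤ ℓ * B ∧
      ∀ ψ ∈ π, ψ.size ≤ B := by
  obtain ⟨π, hπ, hlast, hlen, hok⟩ := h
  refine ⟨π, isBlock_of_isDerivation hπ Γ, List.mem_of_getLast? hlast, ?_, fun ψ hψ => (hok ψ hψ).2⟩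
  unfold proofSize
  calc (π.map PropForm.size).sum ≤ (π.map fun _ => B).sum := List.sum_le_sum fun ψ hψ => (hok ψ hψ).2
    _ = π.length * B := by simp
    _ ≤ ℓ * B := Nat.mul_le_mul_right _ hlen

/-! ### Modus ponens as a block -/

/-- The five lines of modus ponens from `P` and `¬P ∨ Q`: `Q ∨ P` (expansion), `¬Q ∨ Q` (axiom),
`P ∨ Q` (cut = commutativity), `Q ∨ Q` (cut), `Q` (contraction).
[cite: Shoenfield1967, §2.6 (detachment as a derived rule)] -/
def mpBlock (P Q : PropForm ℕ) : List (PropForm ℕ) :=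
  [disj Q P, disj (neg Q) Q, disj P Q, disj Q Q, Q]

/-- Size of the modus ponens block. [folklore] -/
theorem proofSize_mpBlock (P Q : PropForm ℕ) : proofSize (mpBlock P Q) = 2 * P.size + 7 * Q.size + 5 := by
  simp only [mpBlock, proofSize, List.map_cons, List.map_nil, List.sum_cons, List.sum_nil, size]
  ring

/-- The conclusion is in the block. [folklore] -/
theorem mem_mpBlock (P Q : PropForm ℕ) : Q ∈ mpBlock P Q := by simp [mpBlock]

/-- **Modus ponens is a block** over any set containing `P` and `¬P ∨ Q`.
[cite: Shoenfield1967, §2.6 (detachment)] -/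
theorem isBlock_mpBlock {Γ : Set (PropForm ℕ)} {P Q : PropForm ℕ} (hP : P ∈ Γ)
    (hPQ : disj (neg P) Q ∈ Γ) : textbookFrege.IsBlock Γ (mpBlock P Q) := by
  intro k hk
  simp only [mpBlock, List.length_cons, List.length_nil] at hk
  have hr1 : (⟨[var 0], disj (var 1) (var 0)⟩ : FregeRule) ∈ textbookFrege.rules := by simp [textbookFrege]
  have hr0 : (⟨[], disj (neg (var 0)) (var 0)⟩ : FregeRule) ∈ textbookFrege.rules := by simp [textbookFrege]
  have hrc : (⟨[disj (var 0) (var 1), disj (neg (var 0)) (var 2)], disj (var 1) (var 2)⟩ : FregeRule) ∈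
      textbookFrege.rules := by simp [textbookFrege]
  have hrk : (⟨[disj (var 0) (var 0)], var 0⟩ : FregeRule) ∈ textbookFrege.rules := by simp [textbookFrege]
  match k, hk with
  | 0, _ =>
    refine Or.inr (IsInferredFrom.of_rule hr1 (sub3 P Q Q) rfl (prems_cons ?_ prems_nil))
    exact Or.inl hP
  | 1, _ => exact Or.inr (IsInferredFrom.of_rule hr0 (sub3 Q Q Q) rfl prems_nil)
  | 2, _ =>
    refine Or.inr (IsInferredFrom.of_rule hrc (sub3 Q P Q) rfl (prems_cons ?_ (prems_cons ?_ prems_nil)))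
    · exact Or.inr (by simp [mpBlock, PropForm.subst, sub3])
    · exact Or.inr (by simp [mpBlock, PropForm.subst, sub3])
  | 3, _ =>
    refine Or.inr (IsInferredFrom.of_rule hrc (sub3 P Q Q) rfl (prems_cons ?_ (prems_cons ?_ prems_nil)))
    · exact Or.inr (by simp [mpBlock, PropForm.subst, sub3])
    · exact Or.inl hPQ
  | 4, _ =>
    refine Or.inr (IsInferredFrom.of_rule hrk (sub3 Q Q Q) rfl (prems_cons ?_ prems_nil))
    exact Or.inr (by simp [mpBlock, PropForm.subst, sub3])

/-- **Chained modus ponens**: from available antecedents `As` and the available line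
`⋁(As.map neg ++ R)` (that is, `¬A₁ ∨ (¬A₂ ∨ ⋯ (¬A_k ∨ ⋁R))`, in the `disjList` rendering) the
blocks detaching the antecedents one by one, ending with `⋁R`.
[cite: Shoenfield1967, §2.6 (detachment, iterated)] -/
def mpChain : List (PropForm ℕ) → List (PropForm ℕ) → List (PropForm ℕ)
  | [], _ => []
  | A :: As, R => mpBlock A (TextbookFrege.disjList (As.map neg ++ R)) ++ mpChain As R

/-- The chained block is a block and makes `⋁R` available. [folklore] -/
theorem isBlock_mpChain {Γ : Set (PropForm ℕ)} :
    ∀ (As R : List (PropForm ℕ)), (∀ A ∈ As, A ∈ Γ) →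
      TextbookFrege.disjList (As.map neg ++ R) ∈ Γ →
        textbookFrege.IsBlock Γ (mpChain As R) ∧
          TextbookFrege.disjList R ∈ Γ ∪ {χ | χ ∈ mpChain As R}
  | [], R, _, h0 => ⟨IsBlock.nil _ _, Or.inl (by simpa using h0)⟩
  | A :: As, R, hAs, h0 => by
    have hA : A ∈ Γ := hAs A List.mem_cons_self
    have h0' : disj (neg A) (TextbookFrege.disjList (As.map neg ++ R)) ∈ Γ := by
      simpa [TextbookFrege.disjList_cons] using h0
    have hb := isBlock_mpBlock hA h0'
    have hmem : TextbookFrege.disjList (As.map neg ++ R) ∈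
        Γ ∪ {χ | χ ∈ mpBlock A (TextbookFrege.disjList (As.map neg ++ R))} :=
      Or.inr (mem_mpBlock _ _)
    obtain ⟨hrest, hR⟩ := isBlock_mpChain (Γ := Γ ∪ {χ | χ ∈ mpBlock A (TextbookFrege.disjList (As.map neg ++ R))})
      As R (fun B hB => Or.inl (hAs B (List.mem_cons_of_mem _ hB))) hmem
    refine ⟨hb.append hrest, ?_⟩
    rcases hR with (hR | hR) | hR
    · exact Or.inl hR
    · exact Or.inr (by simp only [mpChain, Set.mem_setOf_eq, List.mem_append]; exact Or.inl hR)
    · exact Or.inr (by simp only [mpChain, Set.mem_setOf_eq, List.mem_append]; exact Or.inr hR)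

/-- Size of the chained block: each step costs `2|A| + 7|rest| + 5`. [folklore] -/
theorem proofSize_mpChain_le {W : ℕ} :
    ∀ (As R : List (PropForm ℕ)), (TextbookFrege.disjList (As.map neg ++ R)).size ≤ W →
      proofSize (mpChain As R) ≤ As.length * (9 * W + 5)
  | [], R, _ => by simp [mpChain, proofSize]
  | A :: As, R, hW => by
    have h1 : (TextbookFrege.disjList (As.map neg ++ R)).size ≤ W := by
      have := TextbookFrege.size_disjList_cons (neg A) (As.map neg ++ R)
      simp only [List.map_cons, List.cons_append] at hW
      rw [this] at hW; omega
    have hA : A.size ≤ W := by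
      simp only [List.map_cons, List.cons_append, TextbookFrege.size_disjList_cons, size] at hW; omega
    have ih := proofSize_mpChain_le As R h1
    rw [mpChain, Complexity.proofSize_append, proofSize_mpBlock, List.length_cons]
    nlinarith

/-! ### Removing a trailing `⊥` -/

/-- The seven lines deriving `C` from an available `C ∨ ⊥`: `¬C ∨ C`, `⊥ ∨ C` (cut), `¬⊥`,
`C ∨ ¬⊥` (expansion), `¬⊥ ∨ C` (cut), `C ∨ C` (cut), `C` (contraction).
[cite: Shoenfield1967, §2.6] -/
def removeBotBlock (C : PropForm ℕ) : List (PropForm ℕ) :=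
  [disj (neg C) C, disj (const false) C, neg (const false), disj C (neg (const false)),
    disj (neg (const false)) C, disj C C, C]

/-- Size of the `⊥`-removal block. [folklore] -/
theorem proofSize_removeBotBlock (C : PropForm ℕ) : proofSize (removeBotBlock C) = 8 * C.size + 13 := by
  simp only [removeBotBlock, proofSize, List.map_cons, List.map_nil, List.sum_cons, List.sum_nil, size]
  ring

/-- The conclusion is in the block. [folklore] -/
theorem mem_removeBotBlock (C : PropForm ℕ) : C ∈ removeBotBlock C := by simp [removeBotBlock]

/-- **`⊥`-removal is a block** over any set containing `C ∨ ⊥`. [cite: Shoenfield1967, §2.6] -/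
theorem isBlock_removeBotBlock {Γ : Set (PropForm ℕ)} {C : PropForm ℕ} (hC : disj C (const false) ∈ Γ) :
    textbookFrege.IsBlock Γ (removeBotBlock C) := by
  intro k hk
  simp only [removeBotBlock, List.length_cons, List.length_nil] at hk
  have hr1 : (⟨[var 0], disj (var 1) (var 0)⟩ : FregeRule) ∈ textbookFrege.rules := by simp [textbookFrege]
  have hr0 : (⟨[], disj (neg (var 0)) (var 0)⟩ : FregeRule) ∈ textbookFrege.rules := by simp [textbookFrege]
  have hrc : (⟨[disj (var 0) (var 1), disj (neg (var 0)) (var 2)], disj (var 1) (var 2)⟩ : FregeRule) ∈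
      textbookFrege.rules := by simp [textbookFrege]
  have hrk : (⟨[disj (var 0) (var 0)], var 0⟩ : FregeRule) ∈ textbookFrege.rules := by simp [textbookFrege]
  have hrb : (⟨[], neg (const false)⟩ : FregeRule) ∈ textbookFrege.rules := by simp [textbookFrege]
  match k, hk with
  | 0, _ => exact Or.inr (IsInferredFrom.of_rule hr0 (sub3 C C C) rfl prems_nil)
  | 1, _ =>
    refine Or.inr (IsInferredFrom.of_rule hrc (sub3 C (const false) C) rfl
      (prems_cons ?_ (prems_cons ?_ prems_nil)))
    · exact Or.inl hC
    · exact Or.inr (by simp [removeBotBlock, PropForm.subst, sub3])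
  | 2, _ => exact Or.inr (IsInferredFrom.of_rule hrb (sub3 C C C) rfl prems_nil)
  | 3, _ =>
    refine Or.inr (IsInferredFrom.of_rule hr1 (sub3 (neg (const false)) C C) rfl (prems_cons ?_ prems_nil))
    exact Or.inr (by simp [removeBotBlock, PropForm.subst, sub3])
  | 4, _ =>
    refine Or.inr (IsInferredFrom.of_rule hrc (sub3 C (neg (const false)) C) rfl
      (prems_cons ?_ (prems_cons ?_ prems_nil)))
    · exact Or.inr (by simp [removeBotBlock, PropForm.subst, sub3])
    · exact Or.inr (by simp [removeBotBlock, PropForm.subst, sub3])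
  | 5, _ =>
    refine Or.inr (IsInferredFrom.of_rule hrc (sub3 (const false) C C) rfl
      (prems_cons ?_ (prems_cons ?_ prems_nil)))
    · exact Or.inr (by simp [removeBotBlock, PropForm.subst, sub3])
    · exact Or.inr (by simp [removeBotBlock, PropForm.subst, sub3])
  | 6, _ =>
    refine Or.inr (IsInferredFrom.of_rule hrk (sub3 C C C) rfl (prems_cons ?_ prems_nil))
    exact Or.inr (by simp [removeBotBlock, PropForm.subst, sub3])

/-! ### Packaging -/

/-- **From definitions and a block to an extended Frege proof.** If the definitions `E` are well
allocated above the variables of `φ` (`IsExtList b E`, `φ.bound ≤ b`) and `D` is a block over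
the extension axioms `extAxioms E` containing `φ`, then `φ` has an extended `textbookFrege`-proof
of size at most `proofSize (extAxioms E) + proofSize D`.
[cite: CookReckhow1979, §4 (extension axioms), §2 (derivations)] -/
theorem exists_isEFProofOf_of_isBlock {φ : PropForm ℕ} {b : ℕ} {E : List (ℕ × PropForm ℕ)}
    {D : List (PropForm ℕ)} (hφ : φ.bound ≤ b) (hE : IsExtList b E)
    (hD : textbookFrege.IsBlock {χ | χ ∈ extAxioms E} D) (hmem : φ ∈ D) :
    ∃ π : List (PropForm ℕ), textbookFrege.IsEFProofOf π φ ∧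
      proofSize π ≤ proofSize (extAxioms E) + proofSize D := by
  have h1 : textbookFrege.IsRelaxedEF φ (extAxioms E) := isRelaxedEF_extAxioms hφ hE
  have h2 := h1.append_block hD
  obtain ⟨π, hπ, hs⟩ := h2.exists_isEFProofOf (List.mem_append_right _ hmem)
  exact ⟨π, hπ, hs.trans (by rw [Complexity.proofSize_append])⟩

end TextbookFrege

end Literature.Computability.MetaComplexity
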